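import Mathlib
import Literature.Analysis.UnboundedOperators.ConjugateOperatorRegularity
import HarnessLib
import Summits.AtomisticToContinuum.FouriersLaw.Theorems.EmbeddedDrudeMourreMourreDissolutionLAPQuadraticEstimate
import Summits.AtomisticToContinuum.FouriersLaw.Theorems.EmbeddedDrudeMourreMourreDissolutionLAPCommutatorExpansion

/-!
# Stub `stub_mourreThresholdLAP` — F3b (part 2/2): the matrix-element bound on the error term

Item `stmt-AtomisticToContinuum-12594` (crux `MourreDissolution` of route `EmbeddedDrudeMourre`,
sub-problem `FouriersLaw`), line `separable-vertex-faddeev-pair-sector`, stub S6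
`stub_mourreThresholdLAP` (Mourre's limiting absorption principle, `C²` form), helper F3b of the
proof map (Mourre 1981; ABG = Amrein–Boutet de Monvel–Georgescu 1996, Lemma 7.3.4 eqs.
(7.3.8)–(7.3.10), here for unbounded `H` through its bounded resolvent), part 2/2, over
`…LAPCommutatorExpansion` (notation `R(z)`, `K`, `Kinv`, `K̃inv = 1 - iε G M`,
`G = mourreG U M ε z = R(z) Kinv = K̃inv R(z)`, dissipative `M`, `ε · Im z ≤ 0`, the transition
operator `V = 1 + (z - z₀) R(z)` of the `z₀`-trick, as there).

* §1 norm bookkeeping: `|⟪f, K̃inv v⟫| ≤ (‖f‖ + |ε|‖M‖‖G† f‖) ‖v‖`,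
  `|⟪f, (K̃inv + cG) v⟫| ≤ (‖f‖ + (|ε|‖M‖ + |c|)‖G† f‖) ‖v‖`, `‖(Kinv + cG) f‖ ≤ ‖f‖ + (|ε|‖M‖ + |c|)‖G f‖`;
* §2 THE ERROR-TERM BOUND: for `C = V C₀ V`, `Φ R = R Φ`, `‖(1 - Φ)V‖ ≤ B₁`, `‖V(1 - Φ)‖ ‖Φ‖ ≤ B₂`,
  `|⟪f, K̃inv ((1 - Φ) C + Φ C (1 - Φ)) Kinv f⟫| ≤ ‖C₀‖ (B₁ (‖f‖ + |ε|‖M‖‖G†f‖)(‖f‖ + (|ε|‖M‖ + |z - z₀|)‖Gf‖)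
   + B₂ (‖f‖ + (|ε|‖M‖ + |z - z₀|)‖G†f‖)(‖f‖ + |ε|‖M‖‖Gf‖))`
  (no product `‖G f‖ ‖G† f‖` without a factor `|ε|` — the shape that makes Mourre's differential
  inequality integrable);
* §3 THE ASSEMBLED BOUND on `|⟪f, G M G f⟫|` for `f ∈ D(A)` under the `M`-identity
  `M = -X [R(z), iA] X`, `R X = X R = Φ` (headline `mourreG_sandwich_bound`): the three admissible
  shapes `‖A f‖ (‖G f‖ + ‖G† f‖)`, `|ε| ‖[M, iA]‖ ‖G† f‖ ‖G f‖`, and the error-term bound with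
  `C₀ = [R(z₀), iA]`.
-/

noncomputable section

open MeasureTheory Complex Filter Topology Set
open scoped InnerProductSpace ComplexConjugate ENNReal NNReal

namespace Summit.AtomisticToContinuum.FouriersLaw.Theorems.MourreDissolution

open Literature.Analysis.UnboundedOperators
open Literature.Analysis.UnboundedOperators.UnitaryRep

variable {H : Type*} [NormedAddCommGroup H] [InnerProductSpace ℂ H] [CompleteSpace H]

/-! ## §1. Norm bookkeeping: `K̃inv† f`, `(K̃inv V)† f`, `V Kinv f` -/

/-- **`|⟪f, K̃inv v⟫| ≤ (‖f‖ + |ε| ‖M‖ ‖G† f‖) ‖v‖`** (`K̃inv = 1 - iε G M` and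
`⟪f, G M v⟫ = ⟪G† f, M v⟫`; i.e. `‖K̃inv† f‖ ≤ ‖f‖ + |ε| ‖M‖ ‖G† f‖`).
[cite: AmreinBoutetdeMonvelGeorgescu1996, Lemma 7.3.4] -/
theorem norm_inner_mourreKtinv_apply_le {U : OneParameterUnitaryGroup H} {M : H →L[ℂ] H}
    (hMpos : ∀ f : H, 0 ≤ (⟪f, M f⟫_ℂ).re) {z : ℂ} (hz : z.im ≠ 0) {ε : ℝ} (hεz : ε * z.im ≤ 0)
    (f v : H) :
    ‖⟪f, mourreKtinv U M ε z v⟫_ℂ‖ ≤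
      (‖f‖ + |ε| * ‖M‖ * ‖ContinuousLinearMap.adjoint (mourreG U M ε z) f‖) * ‖v‖ := by
  rw [mourreKtinv_eq hMpos hz hεz U, _root_.sub_apply, one_apply_eq_self, _root_.smul_apply,
    mul_apply_eq_comp, inner_sub_right, inner_smul_right, ← ContinuousLinearMap.adjoint_inner_left]
  calc ‖⟪f, v⟫_ℂ - (I : ℂ) * ε * ⟪ContinuousLinearMap.adjoint (mourreG U M ε z) f, M v⟫_ℂ‖
      ≤ ‖⟪f, v⟫_ℂ‖ + ‖(I : ℂ) * ε * ⟪ContinuousLinearMap.adjoint (mourreG U M ε z) f, M v⟫_ℂ‖ :=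
        norm_sub_le _ _
    _ ≤ ‖f‖ * ‖v‖ + |ε| * (‖ContinuousLinearMap.adjoint (mourreG U M ε z) f‖ * (‖M‖ * ‖v‖)) := by
        rw [norm_mul, norm_mul, Complex.norm_I, one_mul, Complex.norm_real, Real.norm_eq_abs]
        gcongr
        · exact norm_inner_le_norm _ _
        · exact (norm_inner_le_norm _ _).trans (by gcongr; exact M.le_opNorm _)
    _ = (‖f‖ + |ε| * ‖M‖ * ‖ContinuousLinearMap.adjoint (mourreG U M ε z) f‖) * ‖v‖ := by ring

/-- **`|⟪f, (K̃inv + c G) v⟫| ≤ (‖f‖ + (|ε| ‖M‖ + |c|) ‖G† f‖) ‖v‖`** (the factor `K̃inv V =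
K̃inv + (z - z₀) G` of the `z₀`-trick, through its adjoint).
[cite: AmreinBoutetdeMonvelGeorgescu1996, Lemma 7.3.4] -/
theorem norm_inner_mourreKtinv_add_smul_apply_le {U : OneParameterUnitaryGroup H} {M : H →L[ℂ] H}
    (hMpos : ∀ f : H, 0 ≤ (⟪f, M f⟫_ℂ).re) {z : ℂ} (hz : z.im ≠ 0) {ε : ℝ} (hεz : ε * z.im ≤ 0)
    (c : ℂ) (f v : H) :
    ‖⟪f, (mourreKtinv U M ε z + c • mourreG U M ε z) v⟫_ℂ‖ ≤
      (‖f‖ + (|ε| * ‖M‖ + ‖c‖) * ‖ContinuousLinearMap.adjoint (mourreG U M ε z) f‖) * ‖v‖ := by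
  rw [_root_.add_apply, _root_.smul_apply, inner_add_right, inner_smul_right,
    ← ContinuousLinearMap.adjoint_inner_left (mourreG U M ε z) v f]
  calc ‖⟪f, mourreKtinv U M ε z v⟫_ℂ +
        c * ⟪ContinuousLinearMap.adjoint (mourreG U M ε z) f, v⟫_ℂ‖
      ≤ ‖⟪f, mourreKtinv U M ε z v⟫_ℂ‖ +
          ‖c * ⟪ContinuousLinearMap.adjoint (mourreG U M ε z) f, v⟫_ℂ‖ := norm_add_le _ _
    _ ≤ (‖f‖ + |ε| * ‖M‖ * ‖ContinuousLinearMap.adjoint (mourreG U M ε z) f‖) * ‖v‖ +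
          ‖c‖ * (‖ContinuousLinearMap.adjoint (mourreG U M ε z) f‖ * ‖v‖) := by
        rw [norm_mul]
        gcongr
        · exact norm_inner_mourreKtinv_apply_le hMpos hz hεz f v
        · exact norm_inner_le_norm _ _
    _ = _ := by ring

/-- **`‖(Kinv + c G) f‖ ≤ ‖f‖ + (|ε| ‖M‖ + |c|) ‖G f‖`** (the factor `V Kinv = Kinv + (z - z₀) G` of
the `z₀`-trick; `Kinv f = f - iε M (G f)`). [cite: AmreinBoutetdeMonvelGeorgescu1996, Lemma 7.3.4] -/
theorem norm_mourreKinv_add_smul_apply_le {U : OneParameterUnitaryGroup H} {M : H →L[ℂ] H}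
    (hMpos : ∀ f : H, 0 ≤ (⟪f, M f⟫_ℂ).re) {z : ℂ} (hz : z.im ≠ 0) {ε : ℝ} (hεz : ε * z.im ≤ 0)
    (c : ℂ) (f : H) :
    ‖(mourreKinv U M ε z + c • mourreG U M ε z) f‖ ≤
      ‖f‖ + (|ε| * ‖M‖ + ‖c‖) * ‖mourreG U M ε z f‖ := by
  rw [_root_.add_apply, _root_.smul_apply]
  calc ‖mourreKinv U M ε z f + c • mourreG U M ε z f‖
      ≤ ‖mourreKinv U M ε z f‖ + ‖c • mourreG U M ε z f‖ := norm_add_le _ _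
    _ ≤ ‖f‖ + |ε| * ‖M‖ * ‖mourreG U M ε z f‖ + ‖c‖ * ‖mourreG U M ε z f‖ := by
        rw [norm_smul]
        gcongr
        exact norm_mourreKinv_apply_le hMpos hz hεz U f
    _ = _ := by ring

/-! ## §2. The localised error term `D = K̃inv ((1 - Φ) C + Φ C (1 - Φ)) Kinv` and its bound -/

/-- The `z₀`-trick rearrangement of the error term: with `C = V C₀ V` and `Φ V = V Φ`,
`K̃inv ((1 - Φ) C + Φ C (1 - Φ)) Kinv = K̃inv ((1 - Φ) V C₀) (V Kinv) + (K̃inv V) (Φ C₀ (V (1 - Φ))) Kinv`.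
[cite: AmreinBoutetdeMonvelGeorgescu1996, Lemma 7.3.4] -/
theorem errorTerm_eq_of_transition {U : OneParameterUnitaryGroup H} (M : H →L[ℂ] H) (ε : ℝ)
    {z : ℂ} {Φ C C₀ V : H →L[ℂ] H} (hC : C = V * C₀ * V) (hΦV : Φ * V = V * Φ) :
    mourreKtinv U M ε z * ((1 - Φ) * C + Φ * C * (1 - Φ)) * mourreKinv U M ε z =
      mourreKtinv U M ε z * (((1 - Φ) * V * C₀) * (V * mourreKinv U M ε z)) +
        (mourreKtinv U M ε z * V) * ((Φ * C₀ * (V * (1 - Φ))) * mourreKinv U M ε z) := by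
  rw [hC]
  calc mourreKtinv U M ε z * ((1 - Φ) * (V * C₀ * V) + Φ * (V * C₀ * V) * (1 - Φ)) *
        mourreKinv U M ε z
      = mourreKtinv U M ε z * (((1 - Φ) * V * C₀) * (V * mourreKinv U M ε z)) +
          mourreKtinv U M ε z * (Φ * V) * C₀ * (V * (1 - Φ)) * mourreKinv U M ε z := by
        simp only [mul_add, add_mul, mul_assoc]
    _ = _ := by rw [hΦV]; simp only [mul_assoc]

/-- **The matrix-element bound on the localised error term** (ABG (7.3.9)–(7.3.10) in bounded
form, with the `z₀`-trick): if `C = V C₀ V` with `V = 1 + (z - z₀) R(z)` (for `C = [R(z), iA]`,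
`C₀ = [R(z₀), iA]` this is `commutatorCLM_resolventAt_eq_transition`), `Φ` commutes with `R(z)`,
`‖(1 - Φ) V‖ ≤ B₁` and `‖V (1 - Φ)‖ ‖Φ‖ ≤ B₂`, then for every `f`, with `G = G_ε(z)`,
`|⟪f, K̃inv ((1 - Φ) C + Φ C (1 - Φ)) Kinv f⟫| ≤ ‖C₀‖ (B₁ (‖f‖ + |ε|‖M‖‖G† f‖)(‖f‖ + (|ε|‖M‖ + |z - z₀|)‖G f‖)
  + B₂ (‖f‖ + (|ε|‖M‖ + |z - z₀|)‖G† f‖)(‖f‖ + |ε|‖M‖‖G f‖))`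
— every product is `1`, `‖G♯ f‖`, or `‖G f‖ ‖G† f‖` with a factor `|ε|`.
[cite: AmreinBoutetdeMonvelGeorgescu1996, Lemma 7.3.4] -/
theorem norm_inner_errorTerm_le {U : OneParameterUnitaryGroup H} {M : H →L[ℂ] H}
    (hMpos : ∀ f : H, 0 ≤ (⟪f, M f⟫_ℂ).re) {z : ℂ} (hz : z.im ≠ 0) {ε : ℝ} (hεz : ε * z.im ≤ 0)
    {Φ C C₀ : H →L[ℂ] H} {z₀ : ℂ} {B₁ B₂ : ℝ}
    (hC : C = (1 + (z - z₀) • resolventAt U z) * C₀ * (1 + (z - z₀) • resolventAt U z))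
    (hΦ : Φ * resolventAt U z = resolventAt U z * Φ)
    (hB₁ : ‖(1 - Φ) * (1 + (z - z₀) • resolventAt U z)‖ ≤ B₁)
    (hB₂ : ‖(1 + (z - z₀) • resolventAt U z) * (1 - Φ)‖ * ‖Φ‖ ≤ B₂) (f : H) :
    ‖⟪f, (mourreKtinv U M ε z * ((1 - Φ) * C + Φ * C * (1 - Φ)) * mourreKinv U M ε z) f⟫_ℂ‖ ≤
      ‖C₀‖ *
        (B₁ * (‖f‖ + |ε| * ‖M‖ * ‖ContinuousLinearMap.adjoint (mourreG U M ε z) f‖) *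
            (‖f‖ + (|ε| * ‖M‖ + ‖z - z₀‖) * ‖mourreG U M ε z f‖) +
          B₂ * (‖f‖ + (|ε| * ‖M‖ + ‖z - z₀‖) * ‖ContinuousLinearMap.adjoint (mourreG U M ε z) f‖) *
            (‖f‖ + |ε| * ‖M‖ * ‖mourreG U M ε z f‖)) := by
  set V : H →L[ℂ] H := 1 + (z - z₀) • resolventAt U z with hV
  set G := mourreG U M ε z with hG
  set Kinv := mourreKinv U M ε z with hKinv
  set Ktinv := mourreKtinv U M ε z with hKtinv
  have hB₁0 : 0 ≤ B₁ := (norm_nonneg _).trans hB₁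
  have hVK : V * Kinv = Kinv + (z - z₀) • G := transition_mul_mourreKinv U M ε z z₀
  have hKV : Ktinv * V = Ktinv + (z - z₀) • G := mourreKtinv_mul_transition hMpos hz hεz z₀
  have hΦV : Φ * V = V * Φ := mul_transition_comm hΦ (z - z₀)
  have key : (Ktinv * ((1 - Φ) * C + Φ * C * (1 - Φ)) * Kinv) f =
      Ktinv (((1 - Φ) * V * C₀) ((V * Kinv) f)) + (Ktinv * V) ((Φ * C₀ * (V * (1 - Φ))) (Kinv f)) := by
    rw [errorTerm_eq_of_transition M ε hC hΦV]
    simp only [mul_apply_eq_comp, _root_.add_apply]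
    rfl
  -- the two vector norms produced by `Kinv`
  have hVKf : ‖(V * Kinv) f‖ ≤ ‖f‖ + (|ε| * ‖M‖ + ‖z - z₀‖) * ‖G f‖ := by
    rw [hVK]; exact norm_mourreKinv_add_smul_apply_le hMpos hz hεz (z - z₀) f
  have hKf : ‖Kinv f‖ ≤ ‖f‖ + |ε| * ‖M‖ * ‖G f‖ := norm_mourreKinv_apply_le hMpos hz hεz U f
  -- first piece
  have hu₁ : ‖((1 - Φ) * V * C₀) ((V * Kinv) f)‖ ≤
      B₁ * ‖C₀‖ * (‖f‖ + (|ε| * ‖M‖ + ‖z - z₀‖) * ‖G f‖) :=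
    calc ‖((1 - Φ) * V * C₀) ((V * Kinv) f)‖ ≤ ‖(1 - Φ) * V * C₀‖ * ‖(V * Kinv) f‖ :=
          ContinuousLinearMap.le_opNorm _ _
      _ ≤ ‖(1 - Φ) * V‖ * ‖C₀‖ * ‖(V * Kinv) f‖ :=
          mul_le_mul_of_nonneg_right (norm_mul_le _ _) (norm_nonneg _)
      _ ≤ B₁ * ‖C₀‖ * (‖f‖ + (|ε| * ‖M‖ + ‖z - z₀‖) * ‖G f‖) :=
          mul_le_mul (mul_le_mul_of_nonneg_right hB₁ (norm_nonneg _)) hVKf (norm_nonneg _)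
            (mul_nonneg hB₁0 (norm_nonneg _))
  have h₁ : ‖⟪f, Ktinv (((1 - Φ) * V * C₀) ((V * Kinv) f))⟫_ℂ‖ ≤
      (‖f‖ + |ε| * ‖M‖ * ‖ContinuousLinearMap.adjoint G f‖) *
        (B₁ * ‖C₀‖ * (‖f‖ + (|ε| * ‖M‖ + ‖z - z₀‖) * ‖G f‖)) :=
    (norm_inner_mourreKtinv_apply_le hMpos hz hεz f _).trans
      (mul_le_mul_of_nonneg_left hu₁ (by positivity))
  -- second piece
  have hu₂ : ‖(Φ * C₀ * (V * (1 - Φ))) (Kinv f)‖ ≤ B₂ * ‖C₀‖ * (‖f‖ + |ε| * ‖M‖ * ‖G f‖) :=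
    calc ‖(Φ * C₀ * (V * (1 - Φ))) (Kinv f)‖ ≤ ‖Φ * C₀ * (V * (1 - Φ))‖ * ‖Kinv f‖ :=
          ContinuousLinearMap.le_opNorm _ _
      _ ≤ ‖Φ‖ * ‖C₀‖ * ‖V * (1 - Φ)‖ * ‖Kinv f‖ :=
          mul_le_mul_of_nonneg_right norm_mul₃_le (norm_nonneg _)
      _ = ‖V * (1 - Φ)‖ * ‖Φ‖ * ‖C₀‖ * ‖Kinv f‖ := by ring
      _ ≤ B₂ * ‖C₀‖ * (‖f‖ + |ε| * ‖M‖ * ‖G f‖) :=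
          mul_le_mul (mul_le_mul_of_nonneg_right hB₂ (norm_nonneg _)) hKf (norm_nonneg _)
            (mul_nonneg ((by positivity : (0 : ℝ) ≤ ‖V * (1 - Φ)‖ * ‖Φ‖).trans hB₂)
              (norm_nonneg _))
  have h₂ : ‖⟪f, (Ktinv * V) ((Φ * C₀ * (V * (1 - Φ))) (Kinv f))⟫_ℂ‖ ≤
      (‖f‖ + (|ε| * ‖M‖ + ‖z - z₀‖) * ‖ContinuousLinearMap.adjoint G f‖) *
        (B₂ * ‖C₀‖ * (‖f‖ + |ε| * ‖M‖ * ‖G f‖)) := by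
    rw [hKV]
    exact (norm_inner_mourreKtinv_add_smul_apply_le hMpos hz hεz (z - z₀) f _).trans
      (mul_le_mul_of_nonneg_left hu₂ (by positivity))
  rw [key, inner_add_right]
  calc _ ≤ ‖⟪f, Ktinv (((1 - Φ) * V * C₀) ((V * Kinv) f))⟫_ℂ‖ +
        ‖⟪f, (Ktinv * V) ((Φ * C₀ * (V * (1 - Φ))) (Kinv f))⟫_ℂ‖ := norm_add_le _ _
    _ ≤ _ := add_le_add h₁ h₂
    _ = _ := by ring

/-! ## §3. The assembled bound on `⟪f, G M G f⟫` -/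

/-- `|⟪f, iε G M₁ G f⟫| ≤ |ε| ‖M₁‖ ‖G† f‖ ‖G f‖`. [folklore] -/
theorem norm_inner_smul_mourreG_mul_mul_mourreG_le (U : OneParameterUnitaryGroup H)
    (M M₁ : H →L[ℂ] H) (ε : ℝ) (z : ℂ) (f : H) :
    ‖⟪f, (((I : ℂ) * ε) • (mourreG U M ε z * M₁ * mourreG U M ε z)) f⟫_ℂ‖ ≤
      |ε| * ‖M₁‖ * ‖ContinuousLinearMap.adjoint (mourreG U M ε z) f‖ * ‖mourreG U M ε z f‖ := by
  rw [_root_.smul_apply, mul_apply_eq_comp, mul_apply_eq_comp, inner_smul_right,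
    ← ContinuousLinearMap.adjoint_inner_left, norm_mul, norm_mul, Complex.norm_I, one_mul,
    Complex.norm_real, Real.norm_eq_abs]
  calc |ε| * ‖⟪ContinuousLinearMap.adjoint (mourreG U M ε z) f, M₁ (mourreG U M ε z f)⟫_ℂ‖
      ≤ |ε| * (‖ContinuousLinearMap.adjoint (mourreG U M ε z) f‖ * (‖M₁‖ * ‖mourreG U M ε z f‖)) := by
        gcongr
        exact (norm_inner_le_norm _ _).trans (by gcongr; exact M₁.le_opNorm _)
    _ = _ := by ring

/-- `Φ = R X = X R` commutes with `R`. [folklore] -/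
theorem mul_resolventAt_comm_of_eq {U : OneParameterUnitaryGroup H} {z : ℂ} {X Φ : H →L[ℂ] H}
    (hRX : resolventAt U z * X = Φ) (hXR : X * resolventAt U z = Φ) :
    Φ * resolventAt U z = resolventAt U z * Φ := by
  rw [← hRX, mul_assoc, hXR, hRX]

/-- **The bound on `⟪f, G M G f⟫` feeding Mourre's differential inequality** (ABG (7.3.10) in
bounded form): under the `M`-identity `M = -X [R(z), iA] X` (`R X = X R = Φ`), with
`V = 1 + (z - z₀) R(z)`, `C₀ = [R(z₀), iA]`, `‖(1 - Φ) V‖ ≤ B₁`, `‖V (1 - Φ)‖ ‖Φ‖ ≤ B₂`, for every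
`f ∈ D(A)`:
`|⟪f, G M G f⟫| ≤ ‖A f‖ (‖G f‖ + ‖G† f‖) + |ε| ‖[M, iA]‖ ‖G† f‖ ‖G f‖ + ‖C₀‖ (B₁ (…)(…) + B₂ (…)(…))`
(error decomposition `G M G = -[G, iA] - iε G[M, iA]G + D`, the generic bound on `⟪f, [G, iA] f⟫`,
and `norm_inner_errorTerm_le`). [cite: AmreinBoutetdeMonvelGeorgescu1996, Lemma 7.3.4] -/
theorem norm_inner_mourreG_mul_mul_mourreG_le {A U : OneParameterUnitaryGroup H} {M : H →L[ℂ] H}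
    (hMpos : ∀ f : H, 0 ≤ (⟪f, M f⟫_ℂ).re) {z : ℂ} (hz : z.im ≠ 0) {ε : ℝ} (hεz : ε * z.im ≤ 0)
    {z₀ : ℂ} (hz₀ : z₀.im ≠ 0) (hM : A.IsOfClassC1 M) (hR₀ : A.IsOfClassC1 (resolventAt U z₀))
    {X Φ : H →L[ℂ] H} (hRX : resolventAt U z * X = Φ) (hXR : X * resolventAt U z = Φ)
    (hMX : M = -(X * A.commutatorCLM (resolventAt U z) * X)) {B₁ B₂ : ℝ}
    (hB₁ : ‖(1 - Φ) * (1 + (z - z₀) • resolventAt U z)‖ ≤ B₁)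
    (hB₂ : ‖(1 + (z - z₀) • resolventAt U z) * (1 - Φ)‖ * ‖Φ‖ ≤ B₂) {f : H}
    (hf : f ∈ A.hamiltonian.domain) :
    ‖⟪f, (mourreG U M ε z * M * mourreG U M ε z) f⟫_ℂ‖ ≤
      ‖A.hamiltonian ⟨f, hf⟩‖ *
          (‖mourreG U M ε z f‖ + ‖ContinuousLinearMap.adjoint (mourreG U M ε z) f‖) +
        |ε| * ‖A.commutatorCLM M‖ * ‖ContinuousLinearMap.adjoint (mourreG U M ε z) f‖ *
          ‖mourreG U M ε z f‖ +
        ‖A.commutatorCLM (resolventAt U z₀)‖ *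
          (B₁ * (‖f‖ + |ε| * ‖M‖ * ‖ContinuousLinearMap.adjoint (mourreG U M ε z) f‖) *
              (‖f‖ + (|ε| * ‖M‖ + ‖z - z₀‖) * ‖mourreG U M ε z f‖) +
            B₂ * (‖f‖ + (|ε| * ‖M‖ + ‖z - z₀‖) * ‖ContinuousLinearMap.adjoint (mourreG U M ε z) f‖) *
              (‖f‖ + |ε| * ‖M‖ * ‖mourreG U M ε z f‖)) := by
  have hR : A.IsOfClassC1 (resolventAt U z) := isOfClassC1_resolventAt_of_isOfClassC1 hz hz₀ hR₀
  rw [mourreG_mul_mul_mourreG_eq_expansion hMpos hz hεz hM hR hRX hXR hMX, _root_.add_apply,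
    _root_.sub_apply, _root_.neg_apply, inner_add_right, inner_sub_right, inner_neg_right]
  have h₁ := norm_inner_commutatorCLM_mourreG_le hMpos hz hεz hM hR hf
  have h₂ := norm_inner_smul_mourreG_mul_mul_mourreG_le U M (A.commutatorCLM M) ε z f
  have h₃ := norm_inner_errorTerm_le hMpos hz hεz (commutatorCLM_resolventAt_eq_transition hz hz₀ hR₀)
    (mul_resolventAt_comm_of_eq hRX hXR) hB₁ hB₂ f
  calc _ ≤ ‖-⟪f, A.commutatorCLM (mourreG U M ε z) f⟫_ℂ -
          ⟪f, (((I : ℂ) * ε) • (mourreG U M ε z * A.commutatorCLM M * mourreG U M ε z)) f⟫_ℂ‖ +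
        ‖⟪f, (mourreKtinv U M ε z * ((1 - Φ) * A.commutatorCLM (resolventAt U z) +
          Φ * A.commutatorCLM (resolventAt U z) * (1 - Φ)) * mourreKinv U M ε z) f⟫_ℂ‖ :=
        norm_add_le _ _
    _ ≤ ‖⟪f, A.commutatorCLM (mourreG U M ε z) f⟫_ℂ‖ +
          ‖⟪f, (((I : ℂ) * ε) • (mourreG U M ε z * A.commutatorCLM M * mourreG U M ε z)) f⟫_ℂ‖ +
        ‖⟪f, (mourreKtinv U M ε z * ((1 - Φ) * A.commutatorCLM (resolventAt U z) +
          Φ * A.commutatorCLM (resolventAt U z) * (1 - Φ)) * mourreKinv U M ε z) f⟫_ℂ‖ := by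
        gcongr
        exact (norm_sub_le _ _).trans (by rw [norm_neg])
    _ ≤ _ := add_le_add (add_le_add h₁ h₂) h₃

/-! ## §4. Headline (registered helper stub) -/

/-- **The bound on `⟪f, G_ε(z) M G_ε(z) f⟫` for Mourre's differential inequality, headline form**
(all binders explicit; registered helper stub of `stub_mourreThresholdLAP`, S6-PLAN F3b): for
dissipative `M ∈ C¹(A; H)`, a real `ε`, non-real `z, z₀` with `ε · Im z ≤ 0` and
`R(z₀) ∈ C¹(A; H)`, bounded `X, Φ` with `R(z) X = X R(z) = Φ` and the `M`-identity
`M = -X [R(z), iA] X`, and constants `B₁ ≥ ‖(1 - Φ) V‖`, `B₂ ≥ ‖V (1 - Φ)‖ ‖Φ‖`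
(`V = 1 + (z - z₀) R(z)`), every `f ∈ D(A)` satisfies
`|⟪f, G M G f⟫| ≤ ‖A f‖ (‖G f‖ + ‖G† f‖) + |ε| ‖[M, iA]‖ ‖G† f‖ ‖G f‖
  + ‖[R(z₀), iA]‖ (B₁ (‖f‖ + |ε|‖M‖‖G† f‖)(‖f‖ + (|ε|‖M‖ + |z - z₀|)‖G f‖)
      + B₂ (‖f‖ + (|ε|‖M‖ + |z - z₀|)‖G† f‖)(‖f‖ + |ε|‖M‖‖G f‖))`.
[cite: AmreinBoutetdeMonvelGeorgescu1996, Lemma 7.3.4] -/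
theorem mourreG_sandwich_bound :
    ∀ (K : Type) [NormedAddCommGroup K] [InnerProductSpace ℂ K] [CompleteSpace K]
      (U A : Literature.Analysis.UnboundedOperators.OneParameterUnitaryGroup K) (M X Φ : K →L[ℂ] K)
      (ε B₁ B₂ : ℝ) (z z₀ : ℂ), (∀ f : K, 0 ≤ (inner ℂ f (M f)).re) → z.im ≠ 0 → ε * z.im ≤ 0 →
      z₀.im ≠ 0 → A.IsOfClassC1 M →
      A.IsOfClassC1 (Summit.AtomisticToContinuum.FouriersLaw.Theorems.MourreDissolution.resolventAt U z₀) →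
      Summit.AtomisticToContinuum.FouriersLaw.Theorems.MourreDissolution.resolventAt U z * X = Φ →
      X * Summit.AtomisticToContinuum.FouriersLaw.Theorems.MourreDissolution.resolventAt U z = Φ →
      M = -(X * A.commutatorCLM
          (Summit.AtomisticToContinuum.FouriersLaw.Theorems.MourreDissolution.resolventAt U z) * X) →
      ‖(1 - Φ) * (1 + (z - z₀) •
          Summit.AtomisticToContinuum.FouriersLaw.Theorems.MourreDissolution.resolventAt U z)‖ ≤ B₁ →
      ‖(1 + (z - z₀) •
            Summit.AtomisticToContinuum.FouriersLaw.Theorems.MourreDissolution.resolventAt U z) *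
          (1 - Φ)‖ * ‖Φ‖ ≤ B₂ →
      ∀ (f : K) (hf : f ∈ A.hamiltonian.domain),
        ‖inner ℂ f
            ((Summit.AtomisticToContinuum.FouriersLaw.Theorems.MourreDissolution.mourreG U M ε z * M *
                Summit.AtomisticToContinuum.FouriersLaw.Theorems.MourreDissolution.mourreG U M ε z) f)‖ ≤
          ‖A.hamiltonian ⟨f, hf⟩‖ *
                (‖Summit.AtomisticToContinuum.FouriersLaw.Theorems.MourreDissolution.mourreG U M ε z f‖ +
                  ‖ContinuousLinearMap.adjoint
                      (Summit.AtomisticToContinuum.FouriersLaw.Theorems.MourreDissolution.mourreG U M ε z) f‖) +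
              |ε| * ‖A.commutatorCLM M‖ *
                  ‖ContinuousLinearMap.adjoint
                      (Summit.AtomisticToContinuum.FouriersLaw.Theorems.MourreDissolution.mourreG U M ε z) f‖ *
                ‖Summit.AtomisticToContinuum.FouriersLaw.Theorems.MourreDissolution.mourreG U M ε z f‖ +
            ‖A.commutatorCLM
                (Summit.AtomisticToContinuum.FouriersLaw.Theorems.MourreDissolution.resolventAt U z₀)‖ *
              (B₁ * (‖f‖ + |ε| * ‖M‖ *
                    ‖ContinuousLinearMap.adjoint
                        (Summit.AtomisticToContinuum.FouriersLaw.Theorems.MourreDissolution.mourreG U M ε z) f‖) *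
                  (‖f‖ + (|ε| * ‖M‖ + ‖z - z₀‖) *
                    ‖Summit.AtomisticToContinuum.FouriersLaw.Theorems.MourreDissolution.mourreG U M ε z f‖) +
                B₂ * (‖f‖ + (|ε| * ‖M‖ + ‖z - z₀‖) *
                    ‖ContinuousLinearMap.adjoint
                        (Summit.AtomisticToContinuum.FouriersLaw.Theorems.MourreDissolution.mourreG U M ε z) f‖) *
                  (‖f‖ + |ε| * ‖M‖ *
                    ‖Summit.AtomisticToContinuum.FouriersLaw.Theorems.MourreDissolution.mourreG U M ε z f‖)) := by
  intro K _ _ _ U A M X Φ ε B₁ B₂ z z₀ hMpos hz hεz hz₀ hM hR₀ hRX hXR hMX hB₁ hB₂ f hf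
  exact norm_inner_mourreG_mul_mul_mourreG_le hMpos hz hεz hz₀ hM hR₀ hRX hXR hMX hB₁ hB₂ hf

end Summit.AtomisticToContinuum.FouriersLaw.Theorems.MourreDissolution
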